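import Literature.AlgebraicGeometry.Markman2025.KappaClassInvariance

/-!
# Markman 2025 — §7.3 (DEFINITION 7.3.6 p. 43 L53–56; p. 44 L3–10, L28–29, L48–53) and §7.4.2 STEPS 2–4 (p. 48 L16–79):
# the characteristic-class bookkeeping of TWISTED sheaves — `κ(𝓑) := ch(𝓑)exp(−c₁(𝓑)/r)`, `c₁(𝓑^{⊗ρ}) = ρr^{ρ−1}c₁(𝓑)`,
# «the ρ-th root with constant term r», `κ(𝓑) = ch(𝓑)` for trivial determinant, `κ(𝓑) = κ(𝓑′)`, and
# `ch(Ẽ₀) = κ(Ẽ₀)exp(c₁(Ẽ₀)/r) = p^*κ(B)exp(c₁(Ẽ₀)/r)`, and Step 4's diagram chase — the printed one-line deductions,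
# kernel-checked

E. Markman: [M] *Cycles on abelian 2n-folds of Weil type from secant sheaves on abelian n-folds*,
arXiv:2502.03415 **v2** (2025-06-08), bib `Markman2025SecantWeil` — UNREFEREED PREPRINT. «p. N L m» = PyMuPDF line `m` of
page `N` of the public v2 PDF (sha256/16 `8155aa33870069b8`), read BY EYE at seat lit-w-markman g19 (pub-hsemireg LIT-W,
2026-08-24; sheet `LOCATOR-SHEET-MARKMAN.md` §58 = §7.4.2 Steps 1–6) on the 160-dpi renders
`HOME/lit/Markman-renders-litw-markman-g19/` `r_mar25v2_p43_def735_736.png` (`4b8e758bcc5f0fdd`),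
`r_mar25v2_p44_top_lemma737.png` (`b4583922e8a3afdf`), `r_mar25v2_p44_conj739_kappa.png` (`0557a978ff53d44c`),
`r_mar25v2_p48_steps2to4.png` (`106d4663833e6e45`). This file CONTINUES `KappaClassInvariance.lean` (seat g15: the
class `κ(ch) = exp(−ch₁/r)ch` of [M] §1.3 in the degree-`≤ 2` truncation model, `kappa`, `c1_twist`, `kappa_twist`,
`kappa_map`) from the untwisted §1.3 setting to the twisted sheaves of §7.3 and to the proved case §7.4.2 of
CONJECTURE 7.3.9 (row M-Mk4 of the pub-hsemireg LIT-W table; Steps 1, 4, 5, 6 are sheaf theory and stay BY VALUE).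

## What is printed (verbatim, v2, by eye)

* (7.3.4) (p. 43 L49–52): «One has the identity `at_{E⊗F} = at_E ⊗ id_F + id_E ⊗ at_F`, for objects `E, F` in
  `D^b(M, θ)` (see [HL, Sec 10.1]).»
* DEFINITION 7.3.6 (p. 43 L53–56): «Let `𝓑` be a `μ_ρ`-twisted sheaf. Define `c₁(𝓑) ∈ H¹(M, 𝒪_M)` as `tr(at_𝓑)` and
  let `ch(𝓑) ∈ ⊕_q H^q(M, Ω^q_M)` be the trace of the exponential Atiyah class `exp(at_𝓑)`. If `r := rank(𝓑)` is
  non-zero, set `κ(𝓑) := ch(𝓑) exp(−c₁(𝓑)/r)`.» (PRINT-READING PRECISION P-7.3.6: the target of `c₁` is printed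
  `H¹(M, 𝒪_M)` here and `H¹(M, Ω¹_M)` two lines later, p. 44 L3 and Lemma 7.3.7; nothing below depends on it.)
* p. 44 L3–10: «Note that `c₁(𝓑)` belongs to the image in `H¹(M, Ω¹_M)` of the Neron-Severi group tensored with `ℚ`.
  It suffices to show it for `𝓑` of non zero rank `r`. The object `𝓑^{⊗ρ}` is untwisted, and
  `c₁(𝓑^{⊗ρ}) = ρr^{ρ−1}c₁(𝓑)`, by Equation (7.3.4). Similarly, `ch(𝓑)` is a rational class, since
  `ch(𝓑^{⊗ρ}) = ch(𝓑)^ρ` and so `ch(𝓑)` is the `ρ`-th root with constant term `r` of the Chern character `ch(𝓑^{⊗ρ})`.»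
* LEMMA 7.3.7 (p. 44 L11–27, BY VALUE here): «… `𝓑 ≅ 𝓔 ⊗ 𝓛` … Then the following equality holds (7.3.5)
  `at_𝓑 = at_𝓔 − (c₁(𝓔)/r) ⊗ id_𝓔` … Proof. Equation (7.3.4) yields the equality `at_𝓑 = at_𝓔 ⊗ id_𝓛 + id_𝓔 ⊗ at_𝓛`
  and `at_𝓛 = c₁(𝓛)`, which is `−c₁(𝓔)/r`, since `det(𝓑)` is trivial. □»
* p. 44 L28–29: «Let `𝓑` be a `μ_r`-twisted sheaf of positive rank `r` of trivial determinant. In that case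
  `κ(𝓑) = ch(𝓑)`.»
* p. 44 L48–53 (after CONJECTURE 7.3.9): «Note that `ch(𝓑)` remains of Hodge type, if and only if both `c₁(𝓑)` and
  `κ(𝓑)` remain of Hodge type. The locus where `κ(𝓑)` remains of Hodge type contains the one where `ch(𝓑)` does. If
  `κ(𝓑)` remains of Hodge type over `S`, but `ch(𝓑)` does not, we can use Construction 7.3.3 to replace `𝓑` with a
  twisted sheaf `𝓑′` with trivial determinant, which is the tensor product of `𝓑` with a twisted line bundle. The sheaf
  `𝓑′` satisfies `κ(𝓑) = κ(𝓑′)` and `𝓑′` satisfies the hypotheses of Conjecture 7.3.9, since `κ(𝓑′) = ch(𝓑′)`.»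
* §7.4.2 (proof of Conjecture 7.3.9 for connected abelian families), with `Ẽ₀ := (p₀^*B) ⊗ 𝒪_{ℙ(Q₀)}(1)` on the
  projective bundle `p : ℙ → π^{−1}(U)` of Lemma 7.4.1 (Step 1, p. 47 L38 – p. 48 L15). STEP 2 (p. 48 L16–25): «We prove
  next that `c₁(Ẽ₀) ∈ H²(ℙ₀, ℤ)` remains of Hodge type (1, 1) over each fiber of `π ∘ p : ℙ → U`. The line bundle
  `det(Ẽ₀)` is isomorphic to `𝒪_{ℙ(Q₀)}(r)`, since `det(B)` is trivial. … Consequently, so does `c₁(Ẽ₀)`.» STEP 3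
  (p. 48 L26–28): «The Chern character `ch(Ẽ₀)` is equal to `κ(Ẽ₀) exp(c₁(Ẽ₀)/r)`, which is equal to
  `p^*κ(B) exp(c₁(Ẽ₀)/r)`. It remains of Hodge type over every fiber of `π ∘ p : ℙ → U`, since `κ(B)` does, by
  assumption, and `c₁(Ẽ₀)` does, by Step 2.» STEP 4 (p. 48 L29–79; the diagram by eye on render
  `r_mar25v2_p48_step4_diagram_step5.png` `87a9d42ff4103d51`): «We prove next that the sheaf `Ẽ₀` is semiregular. …
  We have the commutative diagram [top row `Ext²(B, B) →(p₀^*)→ Ext²(p₀^*B, p₀^*B) →(≅)→ Ext²(Ẽ₀, Ẽ₀)`, bottom row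
  `⊕_{q=0}^{2n−2} H^{q+2}(Ω^q_{M₀}) →(p₀^*)→ ⊕_{q=0}^{2n+2r−4} H^{q+2}(Ω^q_{ℙ₀}) →(∪ exp(λ/r))→ ⊕_{q=0}^{2n+2r−4} H^{q+2}(Ω^q_{ℙ₀})`,
  vertical maps `σ_B`, `σ_{p₀^*B}`, `σ_{Ẽ₀}`]. The commutativity of the right square follows from Equation (7.3.5). …
  The top horizontal homomorphisms are isomorphisms. The bottom horizontal homomorphisms are injective, and the left
  vertical homomorphism is the semiregularity map `σ_B`, which is assumed to be injective. Hence, the semiregularity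
  map `σ_{Ẽ₀}` is injective as well.»

## The model (= the truncation model of `KappaClassInvariance.lean`; every other input BY VALUE) and what is proved
`A` = a commutative `ℚ`-algebra (for `⊕_q H^q(M, Ω^q_M)`), `ε : A →ₐ[ℚ] ℚ` its `H⁰`-component («constant term» = rank),
`δ : A →ₗ[ℚ] L` its `H¹(Ω¹)`-component (so `δ(ch(𝓑)) = c₁(𝓑)`, the degree-one term of `tr exp(at_𝓑)`), with the Leibniz
rule `δ(xy) = ε(x)δ(y) + ε(y)δ(x)` — this IS (7.3.4) traced in degrees `0, 2`: `rank(E ⊗ F) = rank E · rank F` (ε is an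
algebra map) and `c₁(E ⊗ F) = rank(E)c₁(F) + rank(F)c₁(E)`, the multiplicativity `ch(E ⊗ F) = ch(E)ch(F)` being the
product of `A` — and `s : L →ₗ[ℚ] A` the inclusion (`ε ∘ s = 0`, `δ ∘ s = id`, `s(m)` nilpotent); `exp` = Mathlib's
`IsNilpotent.exp`; `kappa ε δ s ch = exp(−(ε ch)⁻¹ s(δ ch))·ch` = «`κ(𝓑) := ch(𝓑)exp(−c₁(𝓑)/r)`». A second such algebra
`(A′, ε′, δ′, s′)` stands for `ℙ₀` and a graded algebra map `φ = p^* : A → A′` (`ε′ ∘ φ = ε`, `δ′ ∘ φ = φL ∘ δ`,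
`φ ∘ s = s′ ∘ φL`) for the pullback. «Of Hodge type» = membership in a `ℚ`-subalgebra `H` (the Hodge classes form a
subring) which is GRADED in degree 2 (`x ∈ H ⇒ s(δ x) ∈ H`). PROVED (0 `def`, 0 named fact, 0 sorry):
§A `kappa_eq_self_of_c1_zero` («trivial determinant … `κ(𝓑) = ch(𝓑)`», p. 44 L28–29, with `c₁(𝓑) = 0` for the trivial
determinant BY VALUE), `ch_eq_kappa_mul_exp` (Step 3's first equality «`ch(Ẽ₀) = κ(Ẽ₀)exp(c₁(Ẽ₀)/r)`»),
`hodgeType_iff` («`ch(𝓑)` remains of Hodge type, if and only if both `c₁(𝓑)` and `κ(𝓑)` remain of Hodge type»);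
§B `c1_pow` («`c₁(𝓑^{⊗ρ}) = ρr^{ρ−1}c₁(𝓑)`, by Equation (7.3.4)», with `ch(𝓑^{⊗ρ}) = ch(𝓑)^ρ`) and
`rthRoot_unique` («`ch(𝓑)` is THE `ρ`-th root with constant term `r` of `ch(𝓑^{⊗ρ})`»: two classes with constant
term `r ≠ 0` and nilpotent higher part having the same `ρ`-th power are equal — uniqueness of unipotent roots in a
`ℚ`-algebra); §C `construction733` (p. 44 L50–53: twisting by the line bundle with `c₁ = −c₁(𝓑)/r` kills `c₁`, keeps `κ`,
and then `κ(𝓑′) = ch(𝓑′)`); §D `kappa_pullback` (`κ(p^*B) = p^*κ(B)`), `step2_c1` («`det(Ẽ₀) ≅ 𝒪_{ℙ(Q₀)}(r)`, since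
`det(B)` is trivial»: `c₁(p^*B ⊗ 𝒪(1)) = r·c₁(𝒪(1))`), `step3` (both printed equalities of Step 3) and `step3_hodgeType`
(«It remains of Hodge type … since `κ(B)` does, by assumption, and `c₁(Ẽ₀)` does, by Step 2»); §E `step4_injective` (the
diagram chase of Step 4 with both squares commuting — the left square, naturality of `σ` under `p₀^*`, is tacit in print —
using of the top isomorphisms only their surjectivity); private helpers
`exp_mem` (a `ℚ`-subalgebra contains `exp` of its nilpotent elements) and `eq_zero_of_one_add_pow_eq_one` (unipotent roots
of unity are trivial). BY VALUE (printed inputs, not modelled): Atiyah classes (Def. 7.3.5, (7.3.3)), (7.3.4) beyond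
degrees `≤ 2`, Lemma 7.3.7 / (7.3.5), Example 7.3.1 / Remark 7.3.2 / Construction 7.3.3 (Čech data), Lemma 7.4.1, Steps 1, 5, 6 of §7.4.2 and the maps of Step 4's diagram
(Ext² groups, `σ`, `p₀^*`, `∪ exp(λ/r)`, (7.3.5)), [BF1, Th. 5.1], every Hodge-theoretic statement beyond subring membership. Nothing in this file says that Conjecture
7.3.9 holds beyond the printed cases, that HC / HC_CM / HC_AV is proved, or that any object is semiregular.
-/

namespace Literature.AlgebraicGeometry.Markman2025.KappaClass736

open IsNilpotent Literature.AlgebraicGeometry.Markman2025.KappaClass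

variable {A : Type*} [CommRing A] [Algebra ℚ A] {L : Type*} [AddCommGroup L] [Module ℚ L]

section OneSpace

variable (ε : A →ₐ[ℚ] ℚ) (δ : A →ₗ[ℚ] L) (s : L →ₗ[ℚ] A)
  (hδ : ∀ x y, δ (x * y) = ε x • δ y + ε y • δ x) (hεs : ∀ m, ε (s m) = 0) (hδs : ∀ m, δ (s m) = m)
  (hsn : ∀ m, IsNilpotent (s m))

/-! ### §A — Definition 7.3.6 and its two immediate rewrites -/

/-- «Let `𝓑` be a `μ_r`-twisted sheaf of positive rank `r` of trivial determinant. In that case `κ(𝓑) = ch(𝓑)`.» — with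
`c₁(𝓑) = 0` (trivial determinant, BY VALUE) the twist `exp(−c₁(𝓑)/r)` in DEFINITION 7.3.6 is `exp(0) = 1`.
[cite: Markman2025SecantWeil, Definition 7.3.6, p. 43 L53–56; p. 44 L28–29] -/
theorem kappa_eq_self_of_c1_zero (ch : A) (h : δ ch = 0) : kappa ε δ s ch = ch := by
  unfold kappa
  rw [h, map_zero, smul_zero, neg_zero, exp_zero, one_mul]

include hsn in
/-- STEP 3, first equality: «The Chern character `ch(Ẽ₀)` is equal to `κ(Ẽ₀) exp(c₁(Ẽ₀)/r)`» — DEFINITION 7.3.6 read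
backwards, `exp(−c₁/r)·ch·exp(c₁/r) = ch`. [cite: Markman2025SecantWeil, §7.4.2 Step 3, p. 48 L26; Definition 7.3.6,
p. 43 L56] -/
theorem ch_eq_kappa_mul_exp (ch : A) : ch = kappa ε δ s ch * exp ((ε ch)⁻¹ • s (δ ch)) := by
  unfold kappa
  rw [mul_right_comm, exp_neg_mul_exp_self ((hsn _).smul _), one_mul]

/-- A `ℚ`-subalgebra (the Hodge classes) contains `exp` of its nilpotent elements (a finite `ℚ`-combination of powers).
(helper for the «remains of Hodge type» sentences) [folklore] -/
private theorem exp_mem (H : Subalgebra ℚ A) {a : A} (ha : IsNilpotent a) (h : a ∈ H) : exp a ∈ H := by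
  obtain ⟨k, hk⟩ := ha
  rw [exp_eq_sum hk]
  exact Subalgebra.sum_mem H fun i _ => Subalgebra.smul_mem H (Subalgebra.pow_mem H h i) _

include hsn in
/-- «Note that `ch(𝓑)` remains of Hodge type, if and only if both `c₁(𝓑)` and `κ(𝓑)` remain of Hodge type.» — for a
`ℚ`-subalgebra `H` of Hodge classes that contains the degree-2 component of each of its elements (`x ∈ H ⇒ s(δ x) ∈ H`,
the grading): `⇒` by `κ = exp(−c₁/r)·ch`, `⇐` by `ch = κ·exp(c₁/r)`.
[cite: Markman2025SecantWeil, §7.3, p. 44 L48–49] -/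
theorem hodgeType_iff (H : Subalgebra ℚ A) (hH : ∀ x ∈ H, s (δ x) ∈ H) (ch : A) :
    ch ∈ H ↔ s (δ ch) ∈ H ∧ kappa ε δ s ch ∈ H := by
  constructor
  · intro hch
    refine ⟨hH ch hch, ?_⟩
    unfold kappa
    exact Subalgebra.mul_mem H
      (exp_mem H ((hsn _).smul _).neg (Subalgebra.neg_mem H (Subalgebra.smul_mem H (hH ch hch) _))) hch
  · rintro ⟨hc, hk⟩
    rw [ch_eq_kappa_mul_exp ε δ s hsn ch]
    exact Subalgebra.mul_mem H hk (exp_mem H ((hsn _).smul _) (Subalgebra.smul_mem H hc _))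

/-! ### §B — p. 44 L3–10: tensor powers and «the ρ-th root with constant term r» -/

include hδ in
/-- «The object `𝓑^{⊗ρ}` is untwisted, and `c₁(𝓑^{⊗ρ}) = ρr^{ρ−1}c₁(𝓑)`, by Equation (7.3.4).» — with
`ch(𝓑^{⊗ρ}) = ch(𝓑)^ρ` (multiplicativity) and the Leibniz rule (7.3.4) in degree 2, by induction on `ρ` (stated for the
exponent `ρ + 1 ≥ 1`: `c₁(ch^{ρ+1}) = (ρ+1)r^{ρ}c₁(ch)`, `r = ε(ch)`).
[cite: Markman2025SecantWeil, §7.3, p. 44 L7–8; (7.3.4), p. 43 L49–52] -/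
theorem c1_pow (ch : A) (ρ : ℕ) : δ (ch ^ (ρ + 1)) = ((ρ + 1 : ℚ) * (ε ch) ^ ρ) • δ ch := by
  induction ρ with
  | zero => simp
  | succ n ih =>
    rw [_root_.pow_succ, hδ, ih, map_pow, smul_smul, ← add_smul]
    congr 1
    push_cast
    ring

/-- Unipotent roots of unity are trivial in a `ℚ`-algebra: `w` nilpotent, `ρ ≠ 0`, `(1 + w)^ρ = 1 ⇒ w = 0` — since
`(1+w)^ρ − 1 = w·Σ_{i<ρ}(1+w)^i` and `Σ_{i<ρ}(1+w)^i = ρ + (a multiple of w)` is a unit. (helper for `rthRoot_unique`)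
[folklore] -/
private theorem eq_zero_of_one_add_pow_eq_one {w : A} (hw : IsNilpotent w) {ρ : ℕ} (hρ : ρ ≠ 0)
    (h : (1 + w) ^ ρ = 1) : w = 0 := by
  set G := ∑ i ∈ Finset.range ρ, (1 + w) ^ i with hG_def
  have hGw : G * w = 0 := by
    have := geom_sum_mul (1 + w) ρ
    rw [add_sub_cancel_left, h, sub_self] at this
    exact this
  have hdiff : G - (ρ : A) = (∑ i ∈ Finset.range ρ, ∑ j ∈ Finset.range i, (1 + w) ^ j) * w := by
    rw [Finset.sum_mul, hG_def]
    have hρ1 : (ρ : A) = ∑ i ∈ Finset.range ρ, (1 : A) := by simp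
    rw [hρ1, ← Finset.sum_sub_distrib]
    refine Finset.sum_congr rfl fun i _ => ?_
    have := geom_sum_mul (1 + w) i
    rw [add_sub_cancel_left] at this
    exact this.symm
  have hGn : IsNilpotent (G - (ρ : A)) := by
    rw [hdiff]
    exact (Commute.all _ _).isNilpotent_mul_left hw
  have hρu : IsUnit (ρ : A) := by
    have e : (ρ : A) = algebraMap ℚ A (ρ : ℚ) := by simp
    rw [e]
    exact (isUnit_iff_ne_zero.mpr (Nat.cast_ne_zero.mpr hρ)).map _
  have hGu : IsUnit G := by
    have e : G = (ρ : A) + (G - ρ) := by ring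
    rw [e]
    exact hGn.isUnit_add_left_of_commute hρu (Commute.all _ _)
  exact hGu.mul_right_eq_zero.mp hGw

/-- «… `ch(𝓑^{⊗ρ}) = ch(𝓑)^ρ` and so `ch(𝓑)` is THE `ρ`-th root with constant term `r` of the Chern character
`ch(𝓑^{⊗ρ})`» — the uniqueness used: two classes `x, y` with the same constant term `r ≠ 0` and nilpotent higher-degree
parts (`x − r`, `y − r` nilpotent) and `x^ρ = y^ρ`, `ρ ≠ 0`, are equal.
[cite: Markman2025SecantWeil, §7.3, p. 44 L8–10] -/
theorem rthRoot_unique {x y : A} {r : ℚ} (hr : r ≠ 0) {ρ : ℕ} (hρ : ρ ≠ 0)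
    (hx : IsNilpotent (x - algebraMap ℚ A r)) (hy : IsNilpotent (y - algebraMap ℚ A r)) (h : x ^ ρ = y ^ ρ) :
    x = y := by
  -- normalise the constant term to 1: `r⁻¹x = 1 + n`, `r⁻¹y = 1 + m`, `n, m` nilpotent
  have key : ∀ z : A, IsNilpotent (z - algebraMap ℚ A r) → IsNilpotent (r⁻¹ • z - 1) := fun z hz => by
    have := hz.smul r⁻¹
    rwa [smul_sub, Algebra.algebraMap_eq_smul_one, smul_smul, inv_mul_cancel₀ hr, one_smul] at this
  obtain ⟨n, hn, hx1⟩ : ∃ n : A, IsNilpotent n ∧ r⁻¹ • x = 1 + n := ⟨_, key x hx, by rw [add_sub_cancel]⟩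
  obtain ⟨m, hm, hy1⟩ : ∃ m : A, IsNilpotent m ∧ r⁻¹ • y = 1 + m := ⟨_, key y hy, by rw [add_sub_cancel]⟩
  have hpow : (1 + n) ^ ρ = (1 + m) ^ ρ := by rw [← hx1, ← hy1, smul_pow, smul_pow, h]
  obtain ⟨v, hv⟩ := (IsNilpotent.isUnit_one_add hm).exists_right_inv
  -- `u := (1+n)v` is a unipotent `ρ`-th root of unity
  have hu : (1 + ((1 + n) * v - 1)) ^ ρ = 1 := by
    rw [add_sub_cancel, mul_pow, hpow, ← mul_pow, hv, one_pow]
  have hw : IsNilpotent ((1 + n) * v - 1) := by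
    have e : (1 + n) * v - 1 = (n - m) * v := by linear_combination hv
    rw [e]
    exact (Commute.all _ _).isNilpotent_mul_right ((Commute.all _ _).isNilpotent_sub hn hm)
  have h0 : (1 + n) * v = 1 := sub_eq_zero.mp (eq_zero_of_one_add_pow_eq_one hw hρ hu)
  have h1 : 1 + n = 1 + m := by
    calc 1 + n = (1 + n) * v * (1 + m) := by rw [mul_assoc, mul_comm v, hv, mul_one]
      _ = 1 + m := by rw [h0, one_mul]
  calc x = r • (r⁻¹ • x) := by rw [smul_smul, mul_inv_cancel₀ hr, one_smul]
    _ = r • (r⁻¹ • y) := by rw [hx1, h1, ← hy1]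
    _ = y := by rw [smul_smul, mul_inv_cancel₀ hr, one_smul]

/-! ### §C — p. 44 L50–53: Construction 7.3.3's twist to trivial determinant -/

include hδ hεs hδs hsn in
/-- «… we can use Construction 7.3.3 to replace `𝓑` with a twisted sheaf `𝓑′` with trivial determinant, which is the
tensor product of `𝓑` with a twisted line bundle. The sheaf `𝓑′` satisfies `κ(𝓑) = κ(𝓑′)` and … `κ(𝓑′) = ch(𝓑′)`.» — with
`ch(𝓑′) = ch(𝓑)·exp(ℓ)` for the twisting class `ℓ = c₁(𝓛) = −c₁(𝓑)/r` (the line bundle of Construction 7.3.3; its class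
is the one printed in the proof of Lemma 7.3.7, p. 44 L24–26: «`at_𝓛 = c₁(𝓛)`, which is `−c₁(𝓔)/r`, since `det(𝓑)` is
trivial» — BY VALUE): `c₁(𝓑′) = 0`, `κ(𝓑′) = κ(𝓑)` (`kappa_twist` of `KappaClassInvariance.lean`) and `κ(𝓑′) = ch(𝓑′)`.
[cite: Markman2025SecantWeil, §7.3, p. 44 L50–53; Lemma 7.3.7 (proof), p. 44 L24–26; Construction 7.3.3, p. 42 L27–60] -/
theorem construction733 (ch : A) (hr : ε ch ≠ 0) :
    δ (ch * exp (s (-((ε ch)⁻¹ • δ ch)))) = 0 ∧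
      kappa ε δ s (ch * exp (s (-((ε ch)⁻¹ • δ ch)))) = kappa ε δ s ch ∧
      kappa ε δ s (ch * exp (s (-((ε ch)⁻¹ • δ ch)))) = ch * exp (s (-((ε ch)⁻¹ • δ ch))) := by
  have h1 : δ (ch * exp (s (-((ε ch)⁻¹ • δ ch)))) = 0 := by
    rw [c1_twist ε δ s hδ hεs hδs hsn, smul_neg, smul_smul, mul_inv_cancel₀ hr, one_smul, add_neg_cancel]
  exact ⟨h1, kappa_twist ε δ s hδ hεs hδs hsn ch hr _, kappa_eq_self_of_c1_zero ε δ s _ h1⟩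

end OneSpace

/-! ### §D — §7.4.2 Steps 2–3 on the projective bundle `p : ℙ₀ → M₀` -/

section Pullback

variable {A' : Type*} [CommRing A'] [Algebra ℚ A'] {L' : Type*} [AddCommGroup L'] [Module ℚ L']
variable (ε : A →ₐ[ℚ] ℚ) (δ : A →ₗ[ℚ] L) (s : L →ₗ[ℚ] A) (hsn : ∀ m, IsNilpotent (s m))
  (ε' : A' →ₐ[ℚ] ℚ) (δ' : A' →ₗ[ℚ] L') (s' : L' →ₗ[ℚ] A')
  (hδ' : ∀ x y, δ' (x * y) = ε' x • δ' y + ε' y • δ' x) (hεs' : ∀ m, ε' (s' m) = 0) (hδs' : ∀ m, δ' (s' m) = m)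
  (hsn' : ∀ m, IsNilpotent (s' m))
  (φ : A →ₐ[ℚ] A') (φL : L →ₗ[ℚ] L') (hφε : ∀ x, ε' (φ x) = ε x) (hφδ : ∀ x, δ' (φ x) = φL (δ x))
  (hφs : ∀ m, φ (s m) = s' (φL m))

include hsn hφε hφδ hφs in
/-- `κ(p^*B) = p^*κ(B)` for the graded algebra map `φ = p^*` (ranks kept, `c₁` transported): the pullback half of Step 3's
«which is equal to `p^*κ(B) exp(c₁(Ẽ₀)/r)`», via Mathlib's `φ(exp(•)) = exp(φ(•))` (cf. `KappaClass.kappa_map` for an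
endomorphism). [cite: Markman2025SecantWeil, §7.4.2 Step 3, p. 48 L26–27] -/
theorem kappa_pullback (ch : A) : kappa ε' δ' s' (φ ch) = φ (kappa ε δ s ch) := by
  unfold kappa
  rw [map_mul, hφε, hφδ, ← hφs, map_exp ((hsn _).smul _).neg φ, map_neg, map_smul]

include hδ' hεs' hδs' hsn' hφε hφδ in
/-- STEP 2: «The line bundle `det(Ẽ₀)` is isomorphic to `𝒪_{ℙ(Q₀)}(r)`, since `det(B)` is trivial.» — for
`Ẽ₀ = (p₀^*B) ⊗ 𝒪_{ℙ(Q₀)}(1)` with `ch(Ẽ₀) = p^*ch(B)·exp(ℓ)`, `ℓ = c₁(𝒪_{ℙ(Q₀)}(1))` and `c₁(B) = 0`: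
`c₁(Ẽ₀) = r·ℓ`. [cite: Markman2025SecantWeil, §7.4.2 Step 2, p. 48 L16–18; Step 1, p. 48 L9–15] -/
theorem step2_c1 (ch : A) (hdet : δ ch = 0) (ℓ : L') : δ' (φ ch * exp (s' ℓ)) = (ε ch) • ℓ := by
  rw [c1_twist ε' δ' s' hδ' hεs' hδs' hsn', hφδ, hdet, map_zero, zero_add, hφε]

include hsn hδ' hεs' hδs' hsn' hφε hφδ hφs in
/-- STEP 3: «The Chern character `ch(Ẽ₀)` is equal to `κ(Ẽ₀) exp(c₁(Ẽ₀)/r)`, which is equal to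
`p^*κ(B) exp(c₁(Ẽ₀)/r)`.» — for `ch(Ẽ₀) = φ(ch(B))·exp(s′ℓ)`, `r = rank B ≠ 0`: `κ(Ẽ₀) = p^*κ(B)` (twist invariance +
pullback) and `ch(Ẽ₀) = p^*κ(B)·exp(c₁(Ẽ₀)/r)`. [cite: Markman2025SecantWeil, §7.4.2 Step 3, p. 48 L26–27] -/
theorem step3 (ch : A) (hr : ε ch ≠ 0) (ℓ : L') :
    kappa ε' δ' s' (φ ch * exp (s' ℓ)) = φ (kappa ε δ s ch) ∧
      φ ch * exp (s' ℓ) = φ (kappa ε δ s ch) * exp ((ε ch)⁻¹ • s' (δ' (φ ch * exp (s' ℓ)))) := by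
  have hr' : ε' (φ ch) ≠ 0 := by rwa [hφε]
  have hk : kappa ε' δ' s' (φ ch * exp (s' ℓ)) = φ (kappa ε δ s ch) := by
    rw [kappa_twist ε' δ' s' hδ' hεs' hδs' hsn' (φ ch) hr' ℓ,
      kappa_pullback ε δ s hsn ε' δ' s' φ φL hφε hφδ hφs]
  refine ⟨hk, ?_⟩
  have h3 := ch_eq_kappa_mul_exp ε' δ' s' hsn' (φ ch * exp (s' ℓ))
  rw [hk, rank_twist ε' s' hεs' hsn', hφε] at h3
  exact h3

include hsn hδ' hεs' hδs' hsn' hφε hφδ hφs in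
/-- STEP 3, last sentence: «It remains of Hodge type over every fiber of `π ∘ p : ℙ → U`, since `κ(B)` does, by
assumption, and `c₁(Ẽ₀)` does, by Step 2.» — with «of Hodge type» = membership in a `ℚ`-subalgebra `H′` of `A′`:
`p^*κ(B) ∈ H′` and `c₁(Ẽ₀) ∈ H′` give `ch(Ẽ₀) = p^*κ(B)·exp(c₁(Ẽ₀)/r) ∈ H′`.
[cite: Markman2025SecantWeil, §7.4.2 Step 3, p. 48 L27–28] -/
theorem step3_hodgeType (H' : Subalgebra ℚ A') (ch : A) (hr : ε ch ≠ 0) (ℓ : L')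
    (hκ : φ (kappa ε δ s ch) ∈ H') (hc1 : s' (δ' (φ ch * exp (s' ℓ))) ∈ H') :
    φ ch * exp (s' ℓ) ∈ H' := by
  rw [(step3 ε δ s hsn ε' δ' s' hδ' hεs' hδs' hsn' φ φL hφε hφδ hφs ch hr ℓ).2]
  exact Subalgebra.mul_mem H' hκ (exp_mem H' ((hsn' _).smul _) (Subalgebra.smul_mem H' hc1 _))

end Pullback

/-! ### §E — §7.4.2 Step 4: the diagram chase -/

section Step4

variable {X₁ X₂ X₃ Y₁ Y₂ Y₃ : Type*}

/-- STEP 4's conclusion: «The top horizontal homomorphisms are isomorphisms. The bottom horizontal homomorphisms are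
injective, and the left vertical homomorphism is the semiregularity map `σ_B`, which is assumed to be injective. Hence,
the semiregularity map `σ_{Ẽ₀}` is injective as well.» — for a diagram `X₁ →t₁→ X₂ →t₂→ X₃` over `Y₁ →b₁→ Y₂ →b₂→ Y₃` with
vertical maps `σ₁ = σ_B`, `σ₂ = σ_{p₀^*B}`, `σ₃ = σ_{Ẽ₀}` and BOTH squares commuting (the right square «follows from Equation
(7.3.5)»; the left one, naturality of `σ` under `p₀^*`, is tacit in print): `t₁, t₂` surjective (printed: isomorphisms),
`b₁, b₂, σ₁` injective ⇒ `σ₃` injective. The maps themselves are BY VALUE.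
[cite: Markman2025SecantWeil, §7.4.2 Step 4, p. 48 L29–79] -/
theorem step4_injective (σ₁ : X₁ → Y₁) (σ₂ : X₂ → Y₂) (σ₃ : X₃ → Y₃) (t₁ : X₁ → X₂) (t₂ : X₂ → X₃)
    (b₁ : Y₁ → Y₂) (b₂ : Y₂ → Y₃) (hsq₁ : ∀ x, σ₂ (t₁ x) = b₁ (σ₁ x)) (hsq₂ : ∀ x, σ₃ (t₂ x) = b₂ (σ₂ x))
    (ht₁ : Function.Surjective t₁) (ht₂ : Function.Surjective t₂) (hb₁ : Function.Injective b₁)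
    (hb₂ : Function.Injective b₂) (hσ₁ : Function.Injective σ₁) : Function.Injective σ₃ := by
  have hσ₂ : Function.Injective σ₂ := by
    intro y y' h
    obtain ⟨x, rfl⟩ := ht₁ y
    obtain ⟨x', rfl⟩ := ht₁ y'
    rw [hsq₁, hsq₁] at h
    rw [hσ₁ (hb₁ h)]
  intro z z' h
  obtain ⟨y, rfl⟩ := ht₂ z
  obtain ⟨y', rfl⟩ := ht₂ z'
  rw [hsq₂, hsq₂] at h
  rw [hσ₂ (hb₂ h)]

end Step4

end Literature.AlgebraicGeometry.Markman2025.KappaClass736
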